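import Summits.QuantumFields.BalabanUV.T4Continuum.Support.NE7LadderCovariantShift
import Summits.QuantumFields.BalabanUV.T4Continuum.Support.NE3AxialGaugeLadder
import Literature.MathematicalPhysics.QuantumFieldTheory.Balaban1983to89.B8Ineq129
import HarnessLib

/-!
# NE7AxialGaugeGradient — THE LINK GRADIENT OF THE AXIAL GAUGE IN EVERY LATTICE DIRECTION, from the plaquette radius `x` and the covariant
# plaquette-gradient radius `x₁`: on the sup-cube of radius `R` about `y₀`, base `y₀ − (R+1)𝟙`,
# `‖W₀(y + e_τ, μ) − W₀(y, μ)‖ ≤ 2d(R+2)·x₁ + 16d²(R+2)²·x² + 2x` for ALL `τ, μ` (`W₀ = W^{axialFn W base}`)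

Cell `pub-balaban`, rung (B)+1 sub-cell t4, lineage `b2b-balaban-t4-ne7-p1` (CRUX PROVER NE7 #1 = OWNER of row NE7), generation 91; memo
`t4/b2b-balaban-t4-ne7-p1-g91/COVER-OBSTRUCTION.md` §3.  Over F288 `NE7LadderCovariantShift` (insertion of one letter into a ladder word) and
`NE3AxialGaugeLadder` (census R39 of `pub-balaban-gaps`: the direction `τ = μ`).

WHY.  THE CHART of row NE7 ([B8] Thm 2 at `U₀ = 1` TYPE — the one input of `NE7HintOfLocalChartSU2Wide.hint_of_localChart_SU2_wide` specific to NE7) asks, on a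
cube of radius `≍ ℓM`, a gauge with `M·|A| ≤ C₀t` AND `M²·|A(y + e_τ, μ) − A(y, μ)| ≤ C₁t` for EVERY lattice direction `τ`, constants polynomial in `ℓ`.  The AXIAL
gauge gives the first from the plaquette radius `x ≍ t∕M²` alone (`B8Lemma1NonAbelian.axial_bond_bound_sharp`: `|W₀ − 1| ≲ dR·x ≍ ℓ·t∕M`); this file shows it gives
the second from `x` and the covariant plaquette-GRADIENT radius `x₁` (all directions): `|∇W₀| ≲ dR·x₁ + d²R²x² + x`, which is `≍ ℓ·t∕M²` when `x₁ ≍ t∕M³` — the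
[Balaban1985Variational] Thm 1 (9) (`β = 1`) ∕ (10) TYPE regularity of the minimiser.  So THE CHART ⇐ axial-gauge kinematics (this file, F288, R39) ∧ ONE
gauge-invariant local regularity datum of the tangent-critical configuration (the successor's target and the corrected INTERFACE REQUEST NE7).
THE THREE CASES.  `τ = μ`: R39 (`NE3AxialGaugeLadder.norm_axial_bond_sub_bond_le`).  `τ < μ` (§2): both bonds are ladder holonomies at the SAME trunk point `w`,
the second word being the first with ONE letter `(τ, +)` inserted (`treeWord_add_e_split`), so F288's `norm_ladder_insert_sub_le` applies.  `τ > μ` (§3): the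
plaquette identity `W₀(y+e_τ, μ) = W₀(y,τ)⁻¹·W₀(∂p)⁻¹·W₀(y,μ)·W₀(y+e_μ,τ)` reduces it to the case `μ < τ` for the `τ`-link, one plaquette, and the commutator
`[W₀(y,μ), W₀(y,τ)] = O((dRx)²)`.
WHAT ([folklore] lattice gauge kinematics; 0 def, 0 sorry):
§1 `treeWord_add_e_split` (the tree word of `v + e_τ` is that of `v ≥ 0` with one letter `(τ,+)` inserted; the tail consists of forward letters of directions
   `< τ`), `norm_plaqGradDir_gaugeAct` (gauge invariance of the covariant plaquette gradient in any direction), `norm_axial_sub_one_le` (sup letter).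
§2 **`norm_axial_shift_lt_le`** (`τ < μ`), §3 **`norm_axial_shift_gt_le`** (`μ < τ`), §4 **`norm_axial_shift_le_cube`** — EVERY `τ, μ` on the cube of radius `R`:
   `‖W₀(y + e_τ, μ) − W₀(y, μ)‖ ≤ 2d(R+2)·x₁ + 16d²(R+2)²·x² + 2x`.

HONEST FRAMING (page 1): kinematics of an arbitrary unitary lattice configuration; the regularity datum `x₁` is a HYPOTHESIS (for the tangent-critical minimiser
it is [Balaban1985Variational] Thm 1 (9)–(10) TYPE, NOT proved here); THE CHART, (APE) and NE7 NOT proved; nothing of Bałaban's asserted; spine 0∕9; finite T⁴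
rung (B)+1 — NOT infinite volume, NOT mass gap, NOT `BetaPertH`, NOT Clay.  Continuum YM on T⁴ ⇐ BetaPertH ∧ nine spine estimates (0/9 proved); BetaPertH ⇐ (D1) ∧
(D4) ∧ CAP+tail; G-an2-4 gates asym, D1 and NE2/3/4.  No `sorry`; axioms ⊆ {propext, Classical.choice, Quot.sound}.  PLACEMENT: our lemma, under
`Summits/QuantumFields/BalabanUV/`.
-/

set_option autoImplicit false

open scoped BigOperators Matrix Matrix.Norms.L2Operator
open NormedSpace Finset

namespace Summit.QuantumFields.BalabanUV.T4Continuum.NE7AxialGaugeGradient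

open Literature.MathematicalPhysics.QuantumFieldTheory.Balaban1983to89
open B7Prop1Explicit B7Prop2Explicit
open B7Prop1Local (hol_plaqWord_eq)
open B8Lemma1NonAbelian (lowPart lowPart_apply lowPart_sub lowPart_add lowPart_nonneg lowPart_le_self lowPart_zsmul_e_of_lt axial_bond_eq_sharp
  axial_bond_bound_sharp PlaqSmall forward_of_mem_treeWord ne_zero_of_mem_treeWord pairwise_gt_finRange_reverse)
open B8Ineq129 (l1_lowPart_le)
open T4AveragingDeficitWall (Ad IsUnitaryCfg SmallField)
open T4AveragingDeficitNonAbelian (Ad_mul Ad_sub)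
open AveragingDeficitNearIdentity (Ad_one)
open AveragingDeficitTransport (norm_Ad_of_unitary mem_U1_of_unitary)
open NE3LadderCovariantDifference (norm_coe_eq_one)
open NE3AxialGaugeLadder (treeWord_add_of_separated hol_axial_treeWord_of_separated smallField_gaugeAct norm_axial_bond_sub_bond_le)
open NE7LadderCovariantShift (norm_ladder_insert_sub_le)

noncomputable section

variable {d : ℕ} {n : Type*} [Fintype n] [DecidableEq n]

/-! ## §1 Word bookkeeping, gauge invariance, the sup letter -/

/-- **ONE MORE STEP IN DIRECTION `τ`**: for `v ≥ 0` the tree word of `v + e_τ` is the tree word of `v` with ONE forward letter `(τ, +)` inserted; the tail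
behind the insertion point consists of forward letters of directions `< τ` and is no longer than the whole word. [folklore] -/
theorem treeWord_add_e_split (τ : Fin d) {v : Site d} (hv : 0 ≤ v) :
    ∃ A B : List (Letter d), treeWord v = A ++ B ∧ treeWord (v + e τ) = A ++ (τ, true) :: B ∧
      (∀ l ∈ B, l.2 = true ∧ l.1 < τ) ∧ B.length ≤ (treeWord v).length := by
  obtain ⟨s, t, hst⟩ := List.append_of_mem (a := τ) (l := (List.finRange d).reverse) (by simp)
  have hpw := pairwise_gt_finRange_reverse d
  rw [hst] at hpw
  have ht : ∀ κ ∈ t, κ < τ := fun κ hκ => List.rel_of_pairwise_cons (List.pairwise_append.mp hpw).2.1 hκ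
  have hnd : (s ++ τ :: t).Nodup := by
    rw [← hst]; exact List.nodup_reverse.mpr (List.nodup_finRange d)
  have hτst : τ ∉ s ++ t := (List.nodup_cons.mp (List.nodup_middle.mp hnd)).1
  rw [List.mem_append, not_or] at hτst
  let f : Fin d → List (Letter d) := fun κ => seg κ (v κ)
  have hne : ∀ κ, κ ≠ τ → seg κ ((v + e τ) κ) = f κ := by
    intro κ hκ; simp [f, e, hκ]
  obtain ⟨m, hm⟩ : ∃ m : ℕ, v τ = (m : ℤ) := ⟨(v τ).toNat, (Int.toNat_of_nonneg (hv τ)).symm⟩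
  have hττ : seg τ ((v + e τ) τ) = seg τ (v τ) ++ [(τ, true)] := by
    have h1 : (v + e τ) τ = ((m + 1 : ℕ) : ℤ) := by simp [e, hm]
    rw [h1, hm, seg_natCast, seg_natCast, List.replicate_succ']
  have h1 : treeWord v = s.flatMap f ++ (seg τ (v τ) ++ t.flatMap f) := by
    rw [treeWord, hst, List.flatMap_append, List.flatMap_cons]
  have h2 : treeWord (v + e τ) = s.flatMap f ++ ((seg τ (v τ) ++ [(τ, true)]) ++ t.flatMap f) := by
    rw [treeWord, hst, List.flatMap_append, List.flatMap_cons, hττ,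
      flatMap_congr_of (s := s) (fun κ hκ => hne κ (fun h => hτst.1 (h ▸ hκ))),
      flatMap_congr_of (s := t) (fun κ hκ => hne κ (fun h => hτst.2 (h ▸ hκ)))]
  refine ⟨s.flatMap f ++ seg τ (v τ), t.flatMap f, by rw [h1, List.append_assoc], by rw [h2]; simp, ?_, ?_⟩
  · intro l hl
    obtain ⟨κ, hκ, hlκ⟩ := List.mem_flatMap.mp hl
    have hk0 : 0 ≤ v κ := hv κ
    obtain ⟨mκ, hmκ⟩ : ∃ mκ : ℕ, v κ = (mκ : ℤ) := ⟨(v κ).toNat, (Int.toNat_of_nonneg hk0).symm⟩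
    have hl' : l ∈ List.replicate mκ (κ, true) := by simpa [f, hmκ] using hlκ
    rw [(List.mem_replicate.mp hl').2]
    exact ⟨rfl, ht κ hκ⟩
  · rw [h1]; simp only [List.length_append]; omega

/-- The covariant plaquette gradient in ANY direction `τ` is gauge covariant, so its norm is gauge invariant. [folklore] -/
theorem norm_plaqGradDir_gaugeAct [Nonempty n] {W : Site d → Fin d → (Matrix n n ℂ)ˣ} {u : Site d → (Matrix n n ℂ)ˣ}
    (hu : ∀ z, u z ∈ unitaryUnits (Matrix n n ℂ)) (p : Site d) (τ μ κ : Fin d) :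
    ‖Ad (gaugeAct u W p τ) ((hol (gaugeAct u W) (p + e τ) (plaqWord κ μ) : (Matrix n n ℂ)ˣ) : Matrix n n ℂ)
        - ((hol (gaugeAct u W) p (plaqWord κ μ) : (Matrix n n ℂ)ˣ) : Matrix n n ℂ)‖
      = ‖Ad (W p τ) ((hol W (p + e τ) (plaqWord κ μ) : (Matrix n n ℂ)ˣ) : Matrix n n ℂ) - ((hol W p (plaqWord κ μ) : (Matrix n n ℂ)ˣ) : Matrix n n ℂ)‖ := by
  have h1 : Ad (gaugeAct u W p τ) ((hol (gaugeAct u W) (p + e τ) (plaqWord κ μ) : (Matrix n n ℂ)ˣ) : Matrix n n ℂ)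
      - ((hol (gaugeAct u W) p (plaqWord κ μ) : (Matrix n n ℂ)ˣ) : Matrix n n ℂ)
      = Ad (u p) (Ad (W p τ) ((hol W (p + e τ) (plaqWord κ μ) : (Matrix n n ℂ)ˣ) : Matrix n n ℂ) - ((hol W p (plaqWord κ μ) : (Matrix n n ℂ)ˣ) : Matrix n n ℂ)) := by
    have hAdU : ∀ (A Y : (Matrix n n ℂ)ˣ), Ad A (Y : Matrix n n ℂ) = ((A * Y * A⁻¹ : (Matrix n n ℂ)ˣ) : Matrix n n ℂ) := fun A Y => by
      unfold Ad; simp only [Units.val_mul]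
    have hgu : gaugeAct u W p τ * u (p + e τ) = u p * W p τ := by unfold gaugeAct; group
    rw [hol_gaugeAct_closed _ _ _ _ (disp_plaqWord _ _), hol_gaugeAct_closed _ _ _ _ (disp_plaqWord _ _), ← hAdU, ← hAdU,
      ← Ad_mul, hgu, Ad_mul, ← Ad_sub]
  rw [h1, norm_Ad_of_unitary (hu p)]

/-- **THE SUP LETTER OF THE AXIAL GAUGE** (global plaquette radius): for `y ≤ xs`, `‖W^{axial_y}(xs, μ) − 1‖ ≤ |lowPart_μ(xs − y)|₁·x`. [folklore] -/
theorem norm_axial_sub_one_le [Nonempty n] {W : Site d → Fin d → (Matrix n n ℂ)ˣ} (hWu : IsUnitaryCfg W) {x : ℝ} (hWx : SmallField W x)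
    (y xs : Site d) (μ : Fin d) (hy : y ≤ xs) :
    ‖((gaugeAct (axialFn W y) W xs μ : (Matrix n n ℂ)ˣ) : Matrix n n ℂ) - 1‖ ≤ (l1 (lowPart μ (xs - y)) : ℝ) * x := by
  have hU1 : ∀ x' κ, W x' κ ∈ U1 (Matrix n n ℂ) := fun x' κ => mem_U1_of_unitary (hWu x' κ)
  have hP : PlaqSmall W y (xs + e μ) x := fun x' κ₁ κ₂ hne _ _ => hWx x' κ₁ κ₂ hne
  exact axial_bond_bound_sharp W hU1 hP y xs μ le_rfl hy le_rfl

/-! ## §2 The difference in a direction `τ < μ`: one letter inserted into the ladder word -/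

/-- **THE `τ`-DIFFERENCE OF A `μ`-BOND IN THE AXIAL GAUGE, `τ < μ`** (unitary `W`, `SmallField W x`, covariant plaquette gradients in every direction `≤ x₁`;
base `y ≤ xs`): `‖W₀(xs + e_τ, μ) − W₀(xs, μ)‖ ≤ |Q|·x₁ + 2|Q|²·x² + x`, `|Q| = |lowPart_μ(xs − y)|₁` — both bonds are ladder holonomies at the same trunk point,
the second word carrying one more letter `(τ, +)` (`treeWord_add_e_split`, `NE7LadderCovariantShift.norm_ladder_insert_sub_le`). [folklore] -/
theorem norm_axial_shift_lt_le [Nonempty n] {W : Site d → Fin d → (Matrix n n ℂ)ˣ} (hWu : IsUnitaryCfg W) {x x₁ : ℝ} (hx0 : 0 ≤ x)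
    (hWx : SmallField W x)
    (hgrad : ∀ (p : Site d) (τ μ κ : Fin d), κ ≠ μ →
      ‖Ad (W p τ) ((hol W (p + e τ) (plaqWord κ μ) : (Matrix n n ℂ)ˣ) : Matrix n n ℂ) - ((hol W p (plaqWord κ μ) : (Matrix n n ℂ)ˣ) : Matrix n n ℂ)‖ ≤ x₁)
    (y xs : Site d) {τ μ : Fin d} (hτμ : τ < μ) (hy : y ≤ xs) :
    ‖((gaugeAct (axialFn W y) W (xs + e τ) μ : (Matrix n n ℂ)ˣ) : Matrix n n ℂ) - ((gaugeAct (axialFn W y) W xs μ : (Matrix n n ℂ)ˣ) : Matrix n n ℂ)‖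
      ≤ (l1 (lowPart μ (xs - y)) : ℝ) * x₁ + 2 * (l1 (lowPart μ (xs - y)) : ℝ) ^ 2 * x ^ 2 + x := by
  set V₀ : Site d → Fin d → (Matrix n n ℂ)ˣ := gaugeAct (axialFn W y) W with hV₀
  have hau : ∀ z, axialFn W y z ∈ unitaryUnits (Matrix n n ℂ) := fun z => hol_mem_of (S := unitaryUnits (Matrix n n ℂ)) hWu _ _
  have hV₀u : IsUnitaryCfg V₀ := fun z κ =>
    (unitaryUnits _).mul_mem ((unitaryUnits _).mul_mem (hau z) (hWu z κ)) ((unitaryUnits _).inv_mem (hau _))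
  have hV₀x : SmallField V₀ x := smallField_gaugeAct hau hWx
  have hV₀g : ∀ (p : Site d) (κ : Fin d), κ ≠ μ →
      ‖Ad (V₀ p τ) ((hol V₀ (p + e τ) (plaqWord κ μ) : (Matrix n n ℂ)ˣ) : Matrix n n ℂ) - ((hol V₀ p (plaqWord κ μ) : (Matrix n n ℂ)ˣ) : Matrix n n ℂ)‖ ≤ x₁ :=
    fun p κ hκ => by rw [hV₀, norm_plaqGradDir_gaugeAct hau]; exact hgrad p τ μ κ hκ
  -- the low parts, the trunk point
  set Lo : Site d := lowPart μ (xs - y) with hLo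
  have hLo0 : 0 ≤ Lo := lowPart_nonneg μ (sub_nonneg.mpr hy)
  have heτ : lowPart μ (e τ : Site d) = e τ := by
    have := lowPart_zsmul_e_of_lt hτμ 1
    rwa [one_zsmul] at this
  have hLo' : lowPart μ (xs + e τ - y) = Lo + e τ := by
    rw [show xs + e τ - y = (xs - y) + e τ by abel, lowPart_add, heτ]
  set w : Site d := xs - Lo with hw
  have hw' : xs + e τ - (Lo + e τ) = w := by rw [hw]; abel
  -- separation data
  have hu : ∀ κ, κ < μ → (w - y) κ = 0 := fun κ hκ => by
    simp only [hw, hLo, Pi.sub_apply, lowPart_apply, if_pos hκ]; ring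
  have hv : ∀ κ, μ ≤ κ → Lo κ = 0 := fun κ hκ => by rw [hLo, lowPart_apply, if_neg (not_lt.mpr hκ)]
  have hv' : ∀ κ, μ ≤ κ → (Lo + e τ) κ = 0 := fun κ hκ => by
    have hκτ : κ ≠ τ := by rintro rfl; exact (not_lt.mpr hκ) hτμ
    rw [Pi.add_apply, hv κ hκ, e_apply, if_neg hκτ, add_zero]
  -- the two trivial tree holonomies at the trunk point
  have hH : hol V₀ w (treeWord Lo) = 1 := by
    have h := hol_axial_treeWord_of_separated W y μ hu hv
    rwa [show y + (w - y) = w by abel] at h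
  have hH' : hol V₀ w (treeWord (Lo + e τ)) = 1 := by
    have h := hol_axial_treeWord_of_separated W y μ hu hv'
    rwa [show y + (w - y) = w by abel] at h
  -- both bonds are ladder holonomies at `w`
  have hb1 : V₀ xs μ = hol V₀ w (ladder (treeWord Lo) μ) := by
    have h := axial_bond_eq_sharp W y xs μ
    rw [← hV₀, ← hLo, ← hw, hH] at h
    simpa using h
  have hb2 : V₀ (xs + e τ) μ = hol V₀ w (ladder (treeWord (Lo + e τ)) μ) := by
    have h := axial_bond_eq_sharp W y (xs + e τ) μ
    rw [← hV₀, hLo', hw', hH'] at h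
    simpa using h
  -- the word: one letter inserted
  obtain ⟨A, B, hAB, hAB', hB, hBlen⟩ := treeWord_add_e_split τ hLo0
  have hB' : ∀ l ∈ B, l.2 = true ∧ l.1 ≠ μ ∧ l.1 ≠ τ := fun l hl =>
    ⟨(hB l hl).1, ne_of_lt ((hB l hl).2.trans hτμ), ne_of_lt (hB l hl).2⟩
  have hins := norm_ladder_insert_sub_le hV₀u (ne_of_lt hτμ) hx0 hV₀x hV₀g A hB' w
  rw [← hAB', ← hAB, ← hb1, ← hb2] at hins
  refine hins.trans ?_
  have hlen : (B.length : ℝ) ≤ l1 Lo := by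
    have : B.length ≤ l1 Lo := hBlen.trans (by rw [length_treeWord])
    exact_mod_cast this
  have hx10 : 0 ≤ x₁ := (norm_nonneg _).trans (hgrad xs τ μ τ (ne_of_lt hτμ))
  have e1 := mul_le_mul_of_nonneg_right hlen hx10
  have e2 := mul_le_mul_of_nonneg_right (pow_le_pow_left₀ (Nat.cast_nonneg B.length) hlen 2) (sq_nonneg x)
  linarith

/-! ## §3 The difference in a direction `τ > μ`: the plaquette identity -/

/-- Algebra of the plaquette identity: `c = b⁻¹P⁻¹ab′` gives `c − a = b⁻¹P⁻¹a(b′ − b) + b⁻¹(P⁻¹ − 1)ab + b⁻¹(ab − ba)`, and for unitaries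
`‖c − a‖ ≤ ‖b′ − b‖ + ‖P − 1‖ + 2‖a − 1‖·‖b − 1‖`. [folklore] -/
theorem norm_sub_le_of_plaquette [Nonempty n] {a b b' c P : (Matrix n n ℂ)ˣ} (ha : a ∈ unitaryUnits (Matrix n n ℂ))
    (hb : b ∈ unitaryUnits (Matrix n n ℂ)) (hP : P ∈ unitaryUnits (Matrix n n ℂ)) (hc : c = b⁻¹ * P⁻¹ * a * b') :
    ‖(c : Matrix n n ℂ) - (a : Matrix n n ℂ)‖
      ≤ ‖(b' : Matrix n n ℂ) - (b : Matrix n n ℂ)‖ + ‖(P : Matrix n n ℂ) - 1‖ + 2 * ‖(a : Matrix n n ℂ) - 1‖ * ‖(b : Matrix n n ℂ) - 1‖ := by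
  have hbi : ((b⁻¹ : (Matrix n n ℂ)ˣ) : Matrix n n ℂ) * (b : Matrix n n ℂ) = 1 := by rw [← Units.val_mul, inv_mul_cancel, Units.val_one]
  have hkey0 : ((b⁻¹ : (Matrix n n ℂ)ˣ) : Matrix n n ℂ) * (((P⁻¹ : (Matrix n n ℂ)ˣ)) : Matrix n n ℂ) * (a : Matrix n n ℂ) * (b' : Matrix n n ℂ)
        - ((b⁻¹ : (Matrix n n ℂ)ˣ) : Matrix n n ℂ) * (b : Matrix n n ℂ) * (a : Matrix n n ℂ)
      = ((b⁻¹ : (Matrix n n ℂ)ˣ) : Matrix n n ℂ) * (((P⁻¹ : (Matrix n n ℂ)ˣ)) : Matrix n n ℂ) * (a : Matrix n n ℂ) * ((b' : Matrix n n ℂ) - (b : Matrix n n ℂ))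
        + ((b⁻¹ : (Matrix n n ℂ)ˣ) : Matrix n n ℂ) * ((((P⁻¹ : (Matrix n n ℂ)ˣ)) : Matrix n n ℂ) - 1) * ((a : Matrix n n ℂ) * (b : Matrix n n ℂ))
        + ((b⁻¹ : (Matrix n n ℂ)ˣ) : Matrix n n ℂ) * (((a : Matrix n n ℂ) - 1) * ((b : Matrix n n ℂ) - 1) - ((b : Matrix n n ℂ) - 1) * ((a : Matrix n n ℂ) - 1)) := by
    noncomm_ring
  rw [hbi, one_mul] at hkey0
  have hkey : (c : Matrix n n ℂ) - (a : Matrix n n ℂ)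
      = ((b⁻¹ * P⁻¹ * a : (Matrix n n ℂ)ˣ) : Matrix n n ℂ) * ((b' : Matrix n n ℂ) - (b : Matrix n n ℂ))
        + ((b⁻¹ : (Matrix n n ℂ)ˣ) : Matrix n n ℂ) * ((((P⁻¹ : (Matrix n n ℂ)ˣ)) : Matrix n n ℂ) - 1) * ((a * b : (Matrix n n ℂ)ˣ) : Matrix n n ℂ)
        + ((b⁻¹ : (Matrix n n ℂ)ˣ) : Matrix n n ℂ) * (((a : Matrix n n ℂ) - 1) * ((b : Matrix n n ℂ) - 1) - ((b : Matrix n n ℂ) - 1) * ((a : Matrix n n ℂ) - 1)) := by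
    rw [hc]
    simp only [Units.val_mul]
    exact hkey0
  have n1 : ‖((b⁻¹ * P⁻¹ * a : (Matrix n n ℂ)ˣ) : Matrix n n ℂ)‖ = 1 :=
    norm_coe_eq_one ((unitaryUnits _).mul_mem ((unitaryUnits _).mul_mem ((unitaryUnits _).inv_mem hb) ((unitaryUnits _).inv_mem hP)) ha)
  have n2 : ‖((b⁻¹ : (Matrix n n ℂ)ˣ) : Matrix n n ℂ)‖ = 1 := norm_coe_eq_one ((unitaryUnits _).inv_mem hb)
  have n3 : ‖((a * b : (Matrix n n ℂ)ˣ) : Matrix n n ℂ)‖ = 1 := norm_coe_eq_one ((unitaryUnits _).mul_mem ha hb)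
  have n4 : ‖(((P⁻¹ : (Matrix n n ℂ)ˣ)) : Matrix n n ℂ) - 1‖ ≤ ‖(P : Matrix n n ℂ) - 1‖ := norm_inv_sub_one_le (mem_U1_of_unitary hP)
  rw [hkey]
  calc _ ≤ ‖((b⁻¹ * P⁻¹ * a : (Matrix n n ℂ)ˣ) : Matrix n n ℂ) * ((b' : Matrix n n ℂ) - (b : Matrix n n ℂ))‖
        + ‖((b⁻¹ : (Matrix n n ℂ)ˣ) : Matrix n n ℂ) * ((((P⁻¹ : (Matrix n n ℂ)ˣ)) : Matrix n n ℂ) - 1) * ((a * b : (Matrix n n ℂ)ˣ) : Matrix n n ℂ)‖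
        + ‖((b⁻¹ : (Matrix n n ℂ)ˣ) : Matrix n n ℂ) * (((a : Matrix n n ℂ) - 1) * ((b : Matrix n n ℂ) - 1) - ((b : Matrix n n ℂ) - 1) * ((a : Matrix n n ℂ) - 1))‖ :=
          norm_add₃_le
    _ ≤ 1 * ‖(b' : Matrix n n ℂ) - (b : Matrix n n ℂ)‖ + 1 * ‖(P : Matrix n n ℂ) - 1‖ * 1
        + 1 * (‖(a : Matrix n n ℂ) - 1‖ * ‖(b : Matrix n n ℂ) - 1‖ + ‖(b : Matrix n n ℂ) - 1‖ * ‖(a : Matrix n n ℂ) - 1‖) := by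
          refine add_le_add (add_le_add ?_ ?_) ?_
          · rw [← n1]; exact norm_mul_le _ _
          · calc _ ≤ ‖((b⁻¹ : (Matrix n n ℂ)ˣ) : Matrix n n ℂ) * ((((P⁻¹ : (Matrix n n ℂ)ˣ)) : Matrix n n ℂ) - 1)‖ * ‖((a * b : (Matrix n n ℂ)ˣ) : Matrix n n ℂ)‖ :=
                  norm_mul_le _ _
              _ ≤ (‖((b⁻¹ : (Matrix n n ℂ)ˣ) : Matrix n n ℂ)‖ * ‖(((P⁻¹ : (Matrix n n ℂ)ˣ)) : Matrix n n ℂ) - 1‖) * ‖((a * b : (Matrix n n ℂ)ˣ) : Matrix n n ℂ)‖ := by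
                  gcongr; exact norm_mul_le _ _
              _ ≤ 1 * ‖(P : Matrix n n ℂ) - 1‖ * 1 := by rw [n2, n3]; gcongr
          · calc _ ≤ ‖((b⁻¹ : (Matrix n n ℂ)ˣ) : Matrix n n ℂ)‖ * ‖((a : Matrix n n ℂ) - 1) * ((b : Matrix n n ℂ) - 1) - ((b : Matrix n n ℂ) - 1) * ((a : Matrix n n ℂ) - 1)‖ :=
                  norm_mul_le _ _
              _ ≤ 1 * (‖(a : Matrix n n ℂ) - 1‖ * ‖(b : Matrix n n ℂ) - 1‖ + ‖(b : Matrix n n ℂ) - 1‖ * ‖(a : Matrix n n ℂ) - 1‖) := by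
                  rw [n2]
                  refine mul_le_mul_of_nonneg_left ((norm_sub_le _ _).trans (add_le_add (norm_mul_le _ _) (norm_mul_le _ _))) zero_le_one
    _ = _ := by ring

/-- **THE `τ`-DIFFERENCE OF A `μ`-BOND IN THE AXIAL GAUGE, `μ < τ`** (same data): `‖W₀(xs + e_τ, μ) − W₀(xs, μ)‖ ≤ (|Q′|·x₁ + 2|Q′|²·x² + x) + x + 2·(|Q|x)(|Q′|x)`,
`|Q| = |lowPart_μ(xs − y)|₁`, `|Q′| = |lowPart_τ(xs − y)|₁` — the plaquette identity, §2 for the `τ`-link in the direction `μ < τ`, and the commutator of the two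
near-identity bond variables. [folklore] -/
theorem norm_axial_shift_gt_le [Nonempty n] {W : Site d → Fin d → (Matrix n n ℂ)ˣ} (hWu : IsUnitaryCfg W) {x x₁ : ℝ} (hx0 : 0 ≤ x)
    (hWx : SmallField W x)
    (hgrad : ∀ (p : Site d) (τ μ κ : Fin d), κ ≠ μ →
      ‖Ad (W p τ) ((hol W (p + e τ) (plaqWord κ μ) : (Matrix n n ℂ)ˣ) : Matrix n n ℂ) - ((hol W p (plaqWord κ μ) : (Matrix n n ℂ)ˣ) : Matrix n n ℂ)‖ ≤ x₁)
    (y xs : Site d) {τ μ : Fin d} (hμτ : μ < τ) (hy : y ≤ xs) :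
    ‖((gaugeAct (axialFn W y) W (xs + e τ) μ : (Matrix n n ℂ)ˣ) : Matrix n n ℂ) - ((gaugeAct (axialFn W y) W xs μ : (Matrix n n ℂ)ˣ) : Matrix n n ℂ)‖
      ≤ ((l1 (lowPart τ (xs - y)) : ℝ) * x₁ + 2 * (l1 (lowPart τ (xs - y)) : ℝ) ^ 2 * x ^ 2 + x) + x
        + 2 * ((l1 (lowPart μ (xs - y)) : ℝ) * x) * ((l1 (lowPart τ (xs - y)) : ℝ) * x) := by
  set V₀ : Site d → Fin d → (Matrix n n ℂ)ˣ := gaugeAct (axialFn W y) W with hV₀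
  have hau : ∀ z, axialFn W y z ∈ unitaryUnits (Matrix n n ℂ) := fun z => hol_mem_of (S := unitaryUnits (Matrix n n ℂ)) hWu _ _
  have hV₀u : IsUnitaryCfg V₀ := fun z κ =>
    (unitaryUnits _).mul_mem ((unitaryUnits _).mul_mem (hau z) (hWu z κ)) ((unitaryUnits _).inv_mem (hau _))
  have hV₀x : SmallField V₀ x := smallField_gaugeAct hau hWx
  -- the four bond variables and the plaquette `(μ, τ)` at `xs`
  set a : (Matrix n n ℂ)ˣ := V₀ xs μ with ha
  set b : (Matrix n n ℂ)ˣ := V₀ xs τ with hb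
  set b' : (Matrix n n ℂ)ˣ := V₀ (xs + e μ) τ with hb'
  set c : (Matrix n n ℂ)ˣ := V₀ (xs + e τ) μ with hc
  set P : (Matrix n n ℂ)ˣ := hol V₀ xs (plaqWord μ τ) with hP
  have hPeq : P = a * b' * c⁻¹ * b⁻¹ := by rw [hP, hol_plaqWord_eq]
  have hceq : c = b⁻¹ * P⁻¹ * a * b' := by rw [hPeq]; group
  have hPu : P ∈ unitaryUnits (Matrix n n ℂ) := hol_mem_of (S := unitaryUnits (Matrix n n ℂ)) hV₀u _ _
  have h1 := norm_sub_le_of_plaquette (hV₀u xs μ) (hV₀u xs τ) hPu hceq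
  have hxP : ‖(P : Matrix n n ℂ) - 1‖ ≤ x := hV₀x xs μ τ (ne_of_lt hμτ)
  have hbb : ‖(b' : Matrix n n ℂ) - (b : Matrix n n ℂ)‖ ≤ (l1 (lowPart τ (xs - y)) : ℝ) * x₁ + 2 * (l1 (lowPart τ (xs - y)) : ℝ) ^ 2 * x ^ 2 + x :=
    norm_axial_shift_lt_le hWu hx0 hWx hgrad y xs hμτ hy
  have haa : ‖(a : Matrix n n ℂ) - 1‖ ≤ (l1 (lowPart μ (xs - y)) : ℝ) * x := norm_axial_sub_one_le hWu hWx y xs μ hy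
  have hbb1 : ‖(b : Matrix n n ℂ) - 1‖ ≤ (l1 (lowPart τ (xs - y)) : ℝ) * x := norm_axial_sub_one_le hWu hWx y xs τ hy
  refine h1.trans (add_le_add (add_le_add hbb hxP) ?_)
  have := mul_le_mul haa hbb1 (norm_nonneg _) ((norm_nonneg _).trans haa)
  linarith

/-! ## §4 Every direction, on the cube -/

/-- **THE LINK GRADIENT OF THE AXIAL GAUGE IN EVERY DIRECTION, ON THE CUBE.**  For unitary `W` with `SmallField W x` and covariant plaquette gradients `≤ x₁` in every
direction, every centre `y₀`, radius `R`, site `y` with `|y_i − y₀,i| ≤ R`, and ALL directions `τ, μ`: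
`‖W₀(y + e_τ, μ) − W₀(y, μ)‖ ≤ 2d(R+2)·x₁ + 16d²(R+2)²·x² + 2x`, `W₀ = W^{axialFn W (y₀ − (R+1)𝟙)}` (the three cases `τ < μ` (§2), `τ = μ` (census R39
`NE3AxialGaugeLadder.norm_axial_bond_sub_bond_le` at `xs = y + e_μ`), `μ < τ` (§3), with `|lowPart|₁ ≤ |z − base|₁ ≤ 2d(R+1)` for `z = y, y + e_μ`). [folklore] -/
theorem norm_axial_shift_le_cube [Nonempty n] {W : Site d → Fin d → (Matrix n n ℂ)ˣ} (hWu : IsUnitaryCfg W) {x x₁ : ℝ} (hx0 : 0 ≤ x)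
    (hx10 : 0 ≤ x₁) (hWx : SmallField W x)
    (hgrad : ∀ (p : Site d) (τ μ κ : Fin d), κ ≠ μ →
      ‖Ad (W p τ) ((hol W (p + e τ) (plaqWord κ μ) : (Matrix n n ℂ)ˣ) : Matrix n n ℂ) - ((hol W p (plaqWord κ μ) : (Matrix n n ℂ)ˣ) : Matrix n n ℂ)‖ ≤ x₁)
    (y₀ : Site d) (R : ℕ) (y : Site d) (hy : ∀ i, |y i - y₀ i| ≤ (R : ℤ)) (τ μ : Fin d) :
    ‖((gaugeAct (axialFn W (y₀ - fun _ => (R : ℤ) + 1)) W (y + e τ) μ : (Matrix n n ℂ)ˣ) : Matrix n n ℂ)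
        - ((gaugeAct (axialFn W (y₀ - fun _ => (R : ℤ) + 1)) W y μ : (Matrix n n ℂ)ˣ) : Matrix n n ℂ)‖
      ≤ 2 * (d : ℝ) * ((R : ℝ) + 2) * x₁ + 16 * (d : ℝ) ^ 2 * ((R : ℝ) + 2) ^ 2 * x ^ 2 + 2 * x := by
  set yb : Site d := y₀ - fun _ => (R : ℤ) + 1 with hyb
  -- positions relative to the base
  have hyb_le : yb ≤ y := fun i => by
    have h1 := (abs_le.mp (hy i)).1
    show y₀ i - ((R : ℤ) + 1) ≤ y i
    linarith
  have hl1 : ∀ (z : Site d) (ν : Fin d), (∀ i, |z i - y₀ i| ≤ (R : ℤ) + 1) → (l1 (lowPart ν (z - yb)) : ℝ) ≤ 2 * (d : ℝ) * ((R : ℝ) + 2) := by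
    intro z ν hz
    have h3 : l1 (lowPart ν (z - yb)) ≤ l1 (z - yb) := l1_lowPart_le ν _
    have h4 : l1 (z - yb) ≤ d * (2 * R + 2) := by
      unfold l1
      calc ∑ i, ((z - yb) i).natAbs ≤ ∑ _i : Fin d, (2 * R + 2) := Finset.sum_le_sum fun i _ => by
              have h1 := abs_le.mp (hz i)
              have e1 : (z - yb) i = z i - y₀ i + ((R : ℤ) + 1) := by rw [hyb]; simp; ring
              rw [e1]; omega
        _ = d * (2 * R + 2) := by simp
    have h6 : ((l1 (lowPart ν (z - yb)) : ℕ) : ℝ) ≤ ((d * (2 * R + 2) : ℕ) : ℝ) := by exact_mod_cast h3.trans h4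
    refine h6.trans ?_
    push_cast
    nlinarith [(Nat.cast_nonneg d : (0 : ℝ) ≤ d)]
  have hy1 : ∀ i, |y i - y₀ i| ≤ (R : ℤ) + 1 := fun i => (hy i).trans (by linarith)
  have hy2 : ∀ i, |(y + e μ) i - y₀ i| ≤ (R : ℤ) + 1 := fun i => by
    have h1 := abs_le.mp (hy i)
    rw [Pi.add_apply, e_apply, abs_le]
    split_ifs <;> constructor <;> linarith
  have hΛ0 : (0 : ℝ) ≤ 2 * (d : ℝ) * ((R : ℝ) + 2) := by positivity
  rcases lt_trichotomy τ μ with hlt | heq | hgt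
  · -- `τ < μ`: §2
    have h := norm_axial_shift_lt_le hWu hx0 hWx hgrad yb y hlt hyb_le
    refine h.trans ?_
    have hq := hl1 y μ hy1
    have hq0 : (0 : ℝ) ≤ l1 (lowPart μ (y - yb)) := Nat.cast_nonneg _
    have e1 := mul_le_mul_of_nonneg_right hq hx10
    have e2 := mul_le_mul_of_nonneg_right (pow_le_pow_left₀ hq0 hq 2) (sq_nonneg x)
    nlinarith [e1, e2, sq_nonneg x, hΛ0]
  · -- `τ = μ`: census R39
    subst heq
    have h := norm_axial_bond_sub_bond_le hWu hx0 hWx (fun p ν κ hκ => hgrad p ν ν κ hκ) yb (y + e τ) τ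
      (by rw [add_sub_cancel_right]; exact hyb_le)
    rw [add_sub_cancel_right] at h
    refine h.trans ?_
    have hq := hl1 (y + e τ) τ hy2
    have hq0 : (0 : ℝ) ≤ l1 (lowPart τ (y + e τ - yb)) := Nat.cast_nonneg _
    have e1 := mul_le_mul_of_nonneg_right hq hx10
    have e2 := mul_le_mul_of_nonneg_right (pow_le_pow_left₀ hq0 hq 2) (sq_nonneg x)
    nlinarith [e1, e2, sq_nonneg x, hΛ0]
  · -- `μ < τ`: §3
    have h := norm_axial_shift_gt_le hWu hx0 hWx hgrad yb y hgt hyb_le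
    refine h.trans ?_
    have hqτ := hl1 y τ hy1
    have hqμ := hl1 y μ hy1
    have hqτ0 : (0 : ℝ) ≤ l1 (lowPart τ (y - yb)) := Nat.cast_nonneg _
    have hqμ0 : (0 : ℝ) ≤ l1 (lowPart μ (y - yb)) := Nat.cast_nonneg _
    have e1 := mul_le_mul_of_nonneg_right hqτ hx10
    have e2 := mul_le_mul_of_nonneg_right (pow_le_pow_left₀ hqτ0 hqτ 2) (sq_nonneg x)
    have e3 : ((l1 (lowPart μ (y - yb)) : ℝ) * x) * ((l1 (lowPart τ (y - yb)) : ℝ) * x)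
        ≤ (2 * (d : ℝ) * ((R : ℝ) + 2) * x) * (2 * (d : ℝ) * ((R : ℝ) + 2) * x) :=
      mul_le_mul (mul_le_mul_of_nonneg_right hqμ hx0) (mul_le_mul_of_nonneg_right hqτ hx0) (mul_nonneg hqτ0 hx0) (mul_nonneg hΛ0 hx0)
    nlinarith [e1, e2, e3, sq_nonneg x, hΛ0]

end

end Summit.QuantumFields.BalabanUV.T4Continuum.NE7AxialGaugeGradient
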